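import Mathlib.Topology.Order.Compact
import Mathlib.Topology.Instances.Real.Lemmas
import Mathlib.Topology.MetricSpace.Pseudo.Lemmas
import HarnessLib

/-!
# `Balaban1983to89.B15Prop1MinimiserFromBaseUniqueness` — [Balaban1985Variational] = «[15]», Thm 1 p. 279 («there exists exactly one orbit … it is a minimum»), (4) p. 278
# (the residual gauge group), Prop. 8 p. 305; [Balaban1988Convergent] = «[III]», (2.12) p. 256 («the minimal orbit, i.e., the set of minima»):
# THE MINIMISERS OF NEARBY DATA FROM THEOREM 1 AT THE BASE DATUM ALONE — an abstract compactness (moving-constraint Berge) argument that turns the criticality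
# transfer `hcritT`∕`htransfer` of the w1 lineage's (J0′) chart theorem, read at `Crit := IsMinimizer`, into print's Thm 1 AT ONE DATUM + a residual gauge section +
# [15] Prop. 8 at chart points + local uniqueness of constrained critical points

Honest framing: statement-level skeleton of published theorems with citation tags; proofs where landed; nothing here is a claim about the
Yang–Mills mass gap.  Cell `pub-ymgap`, HUMAN RULING D-0149 (width seats), seat `pub-ymgap-dag-n12-w1` (g3; N12 = [B15]; U1a⁺ of the w1 lineage, rule (ii) own-lineage
follow-up); `--kind proof --supports stmt-QuantumFields-20542`; count-neutral; N12 NOT discharged; finite 𝕋⁴ at fixed ε; nothing continuum ∕ ℝ⁴ ∕ OS ∕ mass-gap ∕ Clay.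

WHY.  In `B15Prop1LocalChartAtBaseField.exists_localChart_at_baseField` (and its consumers up to `B15Prop1LinearisedKernelDictionary.hMin_atRecord_of_node00Letters`) the
predicate `Crit : GaugeField → GaugeField → Prop` is a FREE binder shared by the two displayed letters `hcritT` ([15] Sect. F: «Lagrange-critical on the slice near the base ⇒
`Crit Q' U'`») and `hT1u` ([15] Thm 1's uniqueness clause: «`Crit Q' U'` in the class on the fibre ⇒ minimiser», for ALL data near the base).  Choosing
`Crit Q' U' := IsMinimizer av reg 𝔹 (avgFamily av Q') U'` makes `hT1u` the identity, and `hcritT` becomes «a Lagrange-critical slice-chart point near `(0, Q₀)` IS a minimiser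
for its datum».  THIS FILE proves that statement ABSTRACTLY — compact configuration space `X` (print: `SU(2)^{bonds}`), continuous action `A` and datum map `D` (print: `M_𝐁`
on `𝐁`), open class `reg` with a closed-reading class `reg' ⊇ closure reg`, residual gauge maps `Res` (continuous, `A`- and `D`-invariant), an ambient space `Xc ⊇ X`
(complex matrix fields, `ι = coeField`) carrying the chart `χ` (print: `X ↦ exp(X)·U₀` on the slice) — from FOUR letters: (T1@q₀) THEOREM 1 AT THE BASE DATUM («every
configuration of the closed-reading class on the base fibre with action `≤ A(U₀)` lies in the residual orbit of `U₀`» — existence is `U₀` itself); (S) a residual GAUGE SECTION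
near `U₀` (every configuration near `U₀` is carried by a residual gauge into the chart near `x₀`; dag-n12-w6's (σ1)–(σ4) ∕ forest gauge); (P8) CHART-CRITICALITY of minimisers at
chart points near `x₀` ([15] Prop. 8; the base-point case is `B15Prop1BaseCriticalityFromMinimiser.hcrit_of_isMinimizer`); (U) LOCAL UNIQUENESS of chart-critical points on one
fibre near the base (`Literature.Analysis.Calculus.ConstrainedCriticalPointLocallyUnique.exists_nhds_critical_unique` through the fibre dictionary).  EFFECT on the lineage's
per-base-field letter list: {(E) existence, `hcritT`, `hT1u`} ⟸ {(T1@q₀), (S), (P8), (U)} — one theorem of print at ONE datum instead of print's uniqueness for all nearby data.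

THE ARGUMENT.  (§2, moving-constraint Berge step) `W := {U | ∃ g ∈ Res, g·U ∈ 𝒩}` is open; on the compact `C := closure reg ∖ W` the pair `(D, A)` omits
`{D U₀} × (−∞, A U₀]` by (T1@q₀), so by the generalized tube lemma it omits `𝒱 × (−∞, A U₀ + δ)`: closed-class configurations with datum in `𝒱` and action `< A U₀ + δ` are
residual-gauge-close to `U₀`.  (§3) Given a chart-critical `w.1` near `x₀` with `χ w.1 = ι U'`, `U'` on the fibre of `Q'` near `Q₀`: the closed-class minimum `U*` on that fibre
exists (compactness), has `A U* ≤ A U' < A U₀ + δ`, hence (§2 + (S)) a residual translate `U'' = χ x̃` with `x̃` near `x₀`; `U''` is a minimiser over `reg`, hence (P8)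
chart-critical; (U) gives `x̃ = w.1`, so `U' = U''` is a minimiser.

CONTENTS (theorems only; no `def`, no `instance`, no `sorry`).  §1 ★ `isMin_of_thm1AtBase` ((E) from (T1@q₀)).  §2 ★★ `exists_nhds_gauge_mem_of_lt` (the Berge step).
§3 ★★★ `htransfer_isMin_of_thm1AtBase` (the `hcritT`∕`htransfer` binder shape of `exists_localChart_at_baseField` ∕ `exists_localChart_of_criticalFamily_local` at
`Crit := IsMinimizer`, abstract objects).  The record junction (`X := GaugeField P 0 SU2`, `ι := coeField`, `χ x := expMulC ↑x ↑U₀`, `D :=` the `𝐁`-restricted `avgFamily`,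
`Res :=` gauge transformations trivial at the block towers of the constrained bonds) is the successor module.
HONEST SCOPE: point-set topology; nothing of Bałaban's asserted — (T1@q₀), (S), (P8) stay DISPLAYED as hypotheses; count-neutral; N12 NOT discharged; the YM mass gap (Clay) is NOT proved by
any of this — R4 closes only the conditional finite-𝕋⁴ rung `BalabanLadder.UV`.
-/

noncomputable section

namespace Literature.MathematicalPhysics.QuantumFieldTheory.Balaban1983to89.B15Prop1MinimiserFromBaseUniqueness

open Set Filter
open scoped _root_.Topology

/-! ## §1  Existence at the base datum from Theorem 1 at the base datum -/

section Existence

variable {X : Type*} {Y : Type*}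

/-- ★ **(E) FROM THEOREM 1 AT THE BASE DATUM.**  If every configuration of the closed-reading class `reg' ⊇ reg` on the base fibre with action `≤ A U₀` lies in the residual orbit of
`U₀` (print's «exactly one orbit … it is a minimum», read at the one datum `D U₀`), and `U₀ ∈ reg`, then `U₀` is a minimiser over `reg` on its fibre — the letter (E) of the
lineage's chart theorem, in the shape of `B15DeterminingSets.IsMinimizer`. [cite: Balaban1985Variational, Thm 1 p.279; Balaban1988Convergent, (2.12) p.256] -/
theorem isMin_of_thm1AtBase {A : X → ℝ} {D : X → Y} {reg reg' : Set X} {Res : Set (X → X)} {U₀ : X}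
    (hsub : reg ⊆ reg') (hU₀ : U₀ ∈ reg) (hA : ∀ g ∈ Res, ∀ U, A (g U) = A U)
    (hT1 : ∀ U ∈ reg', D U = D U₀ → A U ≤ A U₀ → ∃ g ∈ Res, g U = U₀) :
    U₀ ∈ reg ∧ D U₀ = D U₀ ∧ ∀ V ∈ reg, D V = D U₀ → A U₀ ≤ A V := by
  refine ⟨hU₀, rfl, fun V hV hDV => ?_⟩
  by_contra hle
  have hlt : A V < A U₀ := lt_of_not_ge hle
  obtain ⟨g, hg, hgV⟩ := hT1 V (hsub hV) hDV hlt.le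
  have := hA g hg V
  rw [hgV] at this
  exact absurd this (ne_of_gt hlt)

end Existence

section Transfer

variable {X : Type*} [TopologicalSpace X] [CompactSpace X]
  {Y : Type*} [TopologicalSpace Y] [T2Space Y]
  {Xc : Type*} [TopologicalSpace Xc]
  {E : Type*} [TopologicalSpace E]

/-! ## §2  The moving-constraint Berge step: near-minimal closed-class configurations with nearby data are residual-gauge-close to `U₀` -/

/-- ★★ **UPPER SEMICONTINUITY OF NEAR-MINIMISERS AT A UNIQUE MINIMAL ORBIT.**  `X` compact, `A : X → ℝ` continuous, `D : X → Y` continuous ON the closed-reading class `reg'`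
(`Y` Hausdorff; print's averages are smooth on the small-field region only), residual gauges continuous, `closure reg ⊆ reg'`, and Theorem 1 at the base datum (every `U ∈ reg'` with `D U = D U₀`, `A U ≤ A U₀` lies in the residual orbit of `U₀`).  Then for every neighbourhood `𝒩` of `U₀`
there are a neighbourhood `𝒱` of the base datum `D U₀` and `δ > 0` such that every `U ∈ closure reg` with `D U ∈ 𝒱` and `A U < A U₀ + δ` has a residual translate in `𝒩`.  (The
fixed-constraint maximum theorem is `Literature.Topology.ArgmaxUpperHemicontinuous`; here the constraint `D = q` MOVES with the datum, handled by the generalized tube lemma on the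
image of `(D, A)`.) [cite: BeavisDobbs1990, Thm 3.6 (Maximum Theorem); Balaban1985Variational, Thm 1 p.279] -/
theorem exists_nhds_gauge_mem_of_lt {A : X → ℝ} {D : X → Y} {reg reg' : Set X} {Res : Set (X → X)} {U₀ : X}
    (hA : Continuous A) (hD : ContinuousOn D reg') (hres : ∀ g ∈ Res, Continuous g) (hcl : closure reg ⊆ reg')
    (hT1 : ∀ U ∈ reg', D U = D U₀ → A U ≤ A U₀ → ∃ g ∈ Res, g U = U₀)
    {𝒩 : Set X} (h𝒩 : 𝒩 ∈ 𝓝 U₀) :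
    ∃ 𝒱 ∈ 𝓝 (D U₀), ∃ δ : ℝ, 0 < δ ∧ ∀ U ∈ closure reg, D U ∈ 𝒱 → A U < A U₀ + δ → ∃ g ∈ Res, g U ∈ 𝒩 := by
  -- the open set of configurations with a residual translate in `interior 𝒩`
  set W : Set X := {U | ∃ g ∈ Res, g U ∈ interior 𝒩} with hWdef
  have hW : IsOpen W := by
    have : W = ⋃ g ∈ Res, g ⁻¹' interior 𝒩 := by
      ext U; simp only [hWdef, mem_setOf_eq, mem_iUnion, mem_preimage, exists_prop]
    rw [this]
    exact isOpen_biUnion fun g hg => isOpen_interior.preimage (hres g hg)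
  -- its complement inside the closed class is compact, and `(D, A)` maps it onto a closed set
  set C : Set X := closure reg ∩ Wᶜ with hCdef
  have hC : IsCompact C := (isClosed_closure.inter hW.isClosed_compl).isCompact
  have hCsub : C ⊆ reg' := fun U hU => hcl hU.1
  set K : Set (Y × ℝ) := (fun U => (D U, A U)) '' C with hKdef
  have hK : IsClosed K := (hC.image_of_continuousOn ((hD.mono hCsub).prodMk hA.continuousOn)).isClosed
  -- Theorem 1 at the base datum: `(D, A)` omits `{D U₀} × (-∞, A U₀]` on `C`
  have hnot : ∀ U ∈ C, ¬ (D U = D U₀ ∧ A U ≤ A U₀) := by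
    rintro U ⟨hUcl, hUW⟩ ⟨hDU, hAU⟩
    obtain ⟨g, hg, hgU⟩ := hT1 U (hcl hUcl) hDU hAU
    exact hUW ⟨g, hg, by rw [hgU]; exact mem_interior_iff_mem_nhds.2 h𝒩⟩
  -- a global lower bound of the action
  obtain ⟨Um, -, hUm⟩ := isCompact_univ.exists_isMinOn ⟨U₀, mem_univ _⟩ hA.continuousOn
  have hUm' : ∀ U, A Um ≤ A U := fun U => hUm (mem_univ U)
  -- the compact segment `{D U₀} × [A Um, A U₀]` misses `K`; tube lemma
  have hL : ({D U₀} : Set Y) ×ˢ Icc (A Um) (A U₀) ⊆ Kᶜ := by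
    rintro ⟨y, t⟩ ⟨hy, ht⟩ hmem
    obtain ⟨U, hUC, hUyt⟩ := hmem
    simp only [Prod.mk.injEq] at hUyt
    rw [mem_singleton_iff] at hy
    exact hnot U hUC ⟨hUyt.1.trans hy, hUyt.2 ▸ ht.2⟩
  obtain ⟨u, v, hu, hv, hsu, htv, huv⟩ := generalized_tube_lemma isCompact_singleton isCompact_Icc hK.isOpen_compl hL
  have hAU₀v : A U₀ ∈ v := htv ⟨hUm' U₀, le_rfl⟩
  obtain ⟨δ, hδ, hball⟩ := Metric.isOpen_iff.1 hv (A U₀) hAU₀v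
  refine ⟨u, hu.mem_nhds (hsu rfl), δ, hδ, fun U hUcl hDU hAU => ?_⟩
  by_contra hno
  have hUW : U ∉ W := fun ⟨g, hg, hgU⟩ => hno ⟨g, hg, interior_subset hgU⟩
  have hUK : (D U, A U) ∈ K := ⟨U, ⟨hUcl, hUW⟩, rfl⟩
  have hAv : A U ∈ v := by
    by_cases hle : A U ≤ A U₀
    · exact htv ⟨hUm' U, hle⟩
    · refine hball ?_
      rw [Metric.mem_ball, Real.dist_eq, abs_lt]
      constructor <;> linarith [not_le.1 hle]
  exact huv ⟨hDU, hAv⟩ hUK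

/-! ## §3  The criticality transfer at `Crit := IsMinimizer` from Theorem 1 at the base datum -/

/-- ★★★ **A CHART-CRITICAL POINT NEAR THE BASE IS A MINIMISER** — the `hcritT` ∕ `htransfer` binder of the lineage's chart theorem READ AT `Crit := IsMinimizer`, from the four
letters (T1@q₀) Theorem 1 at the base datum, (S) a residual gauge section near `U₀`, (P8) chart-criticality of minimisers at chart points near `x₀`, (U) local uniqueness of
chart-critical points on a fibre near the base.  Abstract objects: compact `X` (configurations), `A` (action), `D` (datum on `𝐁`, values in a Hausdorff space, continuous on `reg'` and at `Q₀`), open class `reg`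
with `closure reg ⊆ reg'` closed, residual gauge maps `Res` (continuous, `A`- and `D`-invariant), an inducing injection `ι : X → Xc` into the ambient chart space, the chart
`χ : E → Xc` continuous at `x₀` with `χ x₀ = ι U₀`, a continuous extension `Â` of the action to `Xc` near `ι U₀`, the class open at `U₀` in `Xc`-form (`hclass` of
`exists_localChart_at_baseField`), and the abstract criticality predicate `LCrit` on `E`.  Conclusion: for `(w.1, w.2)` near `(x₀, ι Q₀)`, if `χ w.1 = ι U'`, `ι Q' = w.2`, `U'`
lies on the fibre of `Q'` and `w.1` is `LCrit`, then `U'` is a minimiser over `reg` on the fibre of `Q'`. [cite: Balaban1985Variational, Thm 1 p.279, (4) p.278, Prop 8 p.305, Sect. F p.300; Balaban1988Convergent, (2.12) p.256] -/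
theorem htransfer_isMin_of_thm1AtBase {A : X → ℝ} {D : X → Y} {reg reg' : Set X} {Res : Set (X → X)} {U₀ Q₀ : X}
    {ι : X → Xc} {χ : E → Xc} {x₀ : E} {Â : Xc → ℝ} {LCrit : E → Prop}
    (hA : Continuous A) (hreg' : IsClosed reg') (hD : ContinuousOn D reg') (hDQ₀ : ContinuousAt D Q₀) (hcl : closure reg ⊆ reg')
    (hres : ∀ g ∈ Res, Continuous g ∧ (∀ U, A (g U) = A U) ∧ (∀ U, D (g U) = D U))
    -- DISPLAYED (T1@q₀): Theorem 1 at the base datum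
    (hT1 : ∀ U ∈ reg', D U = D U₀ → A U ≤ A U₀ → ∃ g ∈ Res, g U = U₀)
    (hι : _root_.Topology.IsInducing ι) (hιinj : Function.Injective ι)
    (hχ : ContinuousAt χ x₀) (hχ₀ : χ x₀ = ι U₀)
    (hÂ : ContinuousAt Â (ι U₀)) (hÂι : ∀ U, Â (ι U) = A U)
    (hU₀Q₀ : D U₀ = D Q₀)
    (hclass : ∀ᶠ z in 𝓝 (ι U₀), ∀ U' : X, ι U' = z → U' ∈ reg)
    -- DISPLAYED (S): residual gauge section near `U₀`
    (hS : ∀ 𝒪 ∈ 𝓝 x₀, ∀ᶠ U in 𝓝 U₀, ∃ g ∈ Res, ∃ x ∈ 𝒪, ι (g U) = χ x)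
    -- DISPLAYED (P8): a minimiser over `reg` at a chart point near `x₀` is chart-critical
    (hP8 : ∀ᶠ x in 𝓝 x₀, ∀ U' : X, χ x = ι U' → (U' ∈ reg ∧ ∀ V ∈ reg, D V = D U' → A U' ≤ A V) → LCrit x)
    -- (U): local uniqueness of chart-critical points on one fibre near the base datum
    (huniq : ∃ 𝒪 ∈ 𝓝 x₀, ∃ 𝒬 ∈ 𝓝 (D U₀), ∀ (U' U'' : X) (x x' : E), x ∈ 𝒪 → x' ∈ 𝒪 → χ x = ι U' → χ x' = ι U'' →
        D U' ∈ 𝒬 → D U'' = D U' → LCrit x → LCrit x' → x = x') :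
    ∀ᶠ w in 𝓝 (x₀, ι Q₀), ∀ U' Q' : X, χ w.1 = ι U' → ι Q' = w.2 → D U' = D Q' → LCrit w.1 →
      (U' ∈ reg ∧ D U' = D Q' ∧ ∀ V ∈ reg, D V = D Q' → A U' ≤ A V) := by
  -- the class at chart points near `x₀`
  have hclassχ : ∀ᶠ x in 𝓝 x₀, ∀ U' : X, χ x = ι U' → U' ∈ reg := by
    have h : Tendsto χ (𝓝 x₀) (𝓝 (ι U₀)) := hχ₀ ▸ hχ
    filter_upwards [h.eventually hclass] with x hx U' hU'
    exact hx U' hU'.symm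
  obtain ⟨𝒪u, h𝒪u, 𝒬, h𝒬, huniq⟩ := huniq
  -- the neighbourhood of `x₀` on which everything holds
  set 𝒪 : Set E := 𝒪u ∩ {x | ∀ U' : X, χ x = ι U' → (U' ∈ reg ∧ ∀ V ∈ reg, D V = D U' → A U' ≤ A V) → LCrit x} ∩
    {x | ∀ U' : X, χ x = ι U' → U' ∈ reg} with h𝒪def
  have h𝒪 : 𝒪 ∈ 𝓝 x₀ := inter_mem (inter_mem h𝒪u hP8) hclassχ
  -- the gauge section for that neighbourhood, and the Berge step for the resulting neighbourhood of `U₀`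
  have h𝒩 : {U | ∃ g ∈ Res, ∃ x ∈ 𝒪, ι (g U) = χ x} ∈ 𝓝 U₀ := hS 𝒪 h𝒪
  obtain ⟨𝒱, h𝒱, δ, hδ, hBerge⟩ :=
    exists_nhds_gauge_mem_of_lt (reg := reg) hA hD (fun g hg => (hres g hg).1) hcl hT1 h𝒩
  -- the eventual sets: `w.1 ∈ 𝒪`, `Â (χ w.1) < A U₀ + δ`, and `D Q' ∈ 𝒱 ∩ 𝒬` whenever `ι Q' = w.2`
  have h1 : ∀ᶠ x in 𝓝 x₀, x ∈ 𝒪 := h𝒪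
  have h2 : ∀ᶠ x in 𝓝 x₀, Â (χ x) < A U₀ + δ := by
    have hc : ContinuousAt (fun x => Â (χ x)) x₀ := ContinuousAt.comp_of_eq hÂ hχ hχ₀
    refine hc.preimage_mem_nhds (Iio_mem_nhds ?_)
    show Â (χ x₀) < A U₀ + δ
    rw [hχ₀, hÂι]; linarith
  have h3 : ∀ᶠ z in 𝓝 (ι Q₀), ∀ Q' : X, ι Q' = z → D Q' ∈ 𝒱 ∩ 𝒬 := by
    have hT : D ⁻¹' (𝒱 ∩ 𝒬) ∈ 𝓝 Q₀ := hDQ₀.preimage_mem_nhds (by rw [← hU₀Q₀]; exact inter_mem h𝒱 h𝒬)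
    rw [hι.nhds_eq_comap, mem_comap] at hT
    obtain ⟨Tc, hTc, hTsub⟩ := hT
    filter_upwards [hTc] with z hz Q' hQ'
    exact hTsub (show ι Q' ∈ Tc by rwa [hQ'])
  filter_upwards [(h1.and h2).prod_nhds h3] with w hw U' Q' hχU' hιQ' hDU' hcrit
  obtain ⟨⟨hw𝒪, hwA⟩, hwQ⟩ := hw
  have hDQ' : D Q' ∈ 𝒱 ∩ 𝒬 := hwQ Q' hιQ'
  -- `U'` lies in the class
  have hU'reg : U' ∈ reg := hw𝒪.2 U' hχU'
  -- the closed-class minimum on the fibre of `Q'`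
  set S' : Set X := closure reg ∩ (reg' ∩ D ⁻¹' {D Q'}) with hS'def
  have hS'c : IsCompact S' := (isClosed_closure.inter (hD.preimage_isClosed_of_isClosed hreg' isClosed_singleton)).isCompact
  have hmemS' : ∀ U, U ∈ closure reg → D U = D Q' → U ∈ S' := fun U hU hDU => ⟨hU, hcl hU, hDU⟩
  have hU'S : U' ∈ S' := hmemS' U' (subset_closure hU'reg) hDU'
  obtain ⟨Us, hUsS, hUsmin⟩ := hS'c.exists_isMinOn ⟨U', hU'S⟩ hA.continuousOn
  have hUsle : ∀ V ∈ S', A Us ≤ A V := fun V hV => hUsmin hV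
  have hAU' : A U' = Â (χ w.1) := by rw [hχU', hÂι]
  have hAUs : A Us < A U₀ + δ := (hUsle U' hU'S).trans_lt (hAU' ▸ hwA)
  have hDUs : D Us = D Q' := hUsS.2.2
  -- Berge step + gauge section: a residual translate of `Us` is a chart point `χ x̃`, `x̃ ∈ 𝒪`
  obtain ⟨g, hg, hgUs⟩ := hBerge Us hUsS.1 (by rw [hDUs]; exact hDQ'.1) hAUs
  obtain ⟨g', hg', x', hx'𝒪, hιx'⟩ := hgUs
  obtain ⟨hg'c, hg'A, hg'D⟩ := hres g' hg'
  obtain ⟨hgc, hgA, hgD⟩ := hres g hg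
  have hAU'' : A (g' (g Us)) = A Us := by rw [hg'A, hgA]
  have hDU'' : D (g' (g Us)) = D Q' := by rw [hg'D, hgD, hDUs]
  have hU''reg : g' (g Us) ∈ reg := hx'𝒪.2 _ hιx'.symm
  have hU''min : g' (g Us) ∈ reg ∧ ∀ V ∈ reg, D V = D (g' (g Us)) → A (g' (g Us)) ≤ A V := by
    refine ⟨hU''reg, fun V hV hDV => ?_⟩
    rw [hAU'']
    exact hUsle V (hmemS' V (subset_closure hV) (by rw [hDV, hDU'']))
  -- (P8): the translate is chart-critical; (U): it is the given chart point
  have hcrit' : LCrit x' := hx'𝒪.1.2 _ hιx'.symm hU''min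
  have hxx' : w.1 = x' :=
    huniq U' (g' (g Us)) w.1 x' hw𝒪.1.1 hx'𝒪.1.1 hχU' hιx'.symm (hDU'.symm ▸ hDQ'.2) (by rw [hDU'', hDU']) hcrit hcrit'
  have hUU : U' = g' (g Us) := hιinj (by rw [← hχU', hxx', hιx'])
  refine ⟨hU'reg, hDU', fun V hV hDV => ?_⟩
  rw [hUU, hAU'']
  exact hUsle V (hmemS' V (subset_closure hV) hDV)

end Transfer

end Literature.MathematicalPhysics.QuantumFieldTheory.Balaban1983to89.B15Prop1MinimiserFromBaseUniqueness

end
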